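import Mathlib.LinearAlgebra.Charpoly.BaseChange
import Literature.AlgebraicGeometry.Motives.FaltingsECEndAssemblyProofs
import Literature.NumberTheory.EllipticCurves.TateModuleDeterminantProofs
import Literature.NumberTheory.EllipticCurves.TateModuleContinuityProofs
import Literature.NumberTheory.EllipticCurves.TateModuleFinite
import Literature.NumberTheory.EllipticCurves.WeilPairingProofs
import Literature.NumberTheory.EllipticCurves.InertiaInvariantsMultiplicativeProofs
import Literature.NumberTheory.EllipticCurves.TateModuleUnipotentInertiaProofs
import Literature.NumberTheory.EllipticCurves.TateModuleTwistTransportProofs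
import Literature.NumberTheory.EllipticCurves.QuadraticTwistMultiplicativeReductionProofs
import Literature.NumberTheory.EllipticCurves.QuadraticTwistTateFormProofs
import Literature.NumberTheory.GaloisRepresentations.OddAbsolutelyIrreducibleProofs
import HarnessLib

/-!
# Faltings 1983, Satz 4 for an elliptic curve: the core fact at a real place, at a
# multiplicative place, and at a place `v ∤ ℓ` of non-integral `j`

Theorem-only `Proofs` companion of `Literature.AlgebraicGeometry.Motives.FaltingsECEndCore`, which
vendors the named fact
`Literature.AlgebraicGeometry.Motives.exists_eq_smul_one_of_equivariant_of_not_hasRationalCM W ℓ`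
— the residual core of G. Faltings, *Endlichkeitssätze für abelsche Varietäten über
Zahlkörpern*, Invent. Math. 73 (1983), §5 Satz 4 for `A = E` an elliptic curve over a number
field `K` (Engl. transl.: Cornell–Silverman, *Arithmetic Geometry*, Ch. II, §5 Theorem 4; held
copy `book:cornellnd-arithmetic-geometry`, PDF pp. 89–90): for `End_K(E) = ℤ` and `V_ℓ E`
without `Γ_K`-stable `ℚ_ℓ`-line, every `Γ_K`-equivariant endomorphism of `V_ℓ E` is a scalar
(`End_{Γ_K}(V_ℓ E) = ℚ_ℓ`; equivalently the image of `Γ_K` in `GL(V_ℓ E)` is not abelian,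
`FaltingsECEndCoreProofs`). After `WeierstrassCurve.shafarevich_finite_goodReductionOutside_holds`
(Shafarevich's Thm. IX.6.1, `ShafarevichGoodReductionProofs`) and
`WeierstrassCurve.finite_isogenyClass_holds` (Cor. IX.6.2, `IsogenyClassFiniteProofs`) this fact
is *all* that separates the tree from Satz 4 for `E` (`FaltingsECEndAssemblyProofs`) and from
Faltings' subspace statement for `E × E` (`FaltingsECSubspacesProofs`).

The one obstruction is an irreducible but not absolutely irreducible `V_ℓ E`: its commutant would
be a quadratic field `F' ⊃ ℚ_ℓ` with `ρ_ℓ(Γ_K) ⊆ F'ˣ` abelian (J.-P. Serre, *Abelian ℓ-adic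
representations and elliptic curves* (1968), Ch. IV, §2.2: the image is not contained in a
non-split Cartan subgroup). In linear algebra: a non-scalar equivariant `G` puts every `ρ_ℓ(σ)`
in `ℚ_ℓ + ℚ_ℓ G` (`commute_of_forall_commute_of_not_exists_eq_smul_one`, `FaltingsECEndCoreProofs`),
so the `ρ_ℓ(σ)` commute pairwise, and then the common fixed space of **any** subset of `Γ_K` is
`Γ_K`-stable; if some subset fixes exactly a line, irreducibility is contradicted
(`exists_eq_smul_one_of_forall_commute_of_fixed_line`). This file **proves the core fact** in the
three situations where the tree exhibits such a subset:

1. **`K` has a real place** (in particular `K = ℚ`): a complex conjugation `c ∈ Γ_K` attached to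
   a real embedding `φ : K →+* ℝ` (`Literature.NumberTheory.GaloisRepresentations.exists_isComplexConjugation`)
   is an involution with `det ρ_ℓ(c) = χ_ℓ(c) = -1` (the Weil pairing,
   `WeierstrassCurve.det_galoisRepTate_eq_cyclotomicCharacter` with
   `WeierstrassCurve.exists_weilPairing_holds`, *AEC* III.8; `χ_ℓ(c) = -1`,
   `GaloisRep.cyclotomicCharacter_of_isComplexConjugation`, Serre 1968, I.1.2), so it fixes
   exactly a line of the plane `V_ℓ E` (an involution inside `F'ˣ` would be `±1`, of
   determinant `1`).
2. **`E` has multiplicative reduction at a finite place `v ∤ ℓ`**: the inertia group `I_𝔓`,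
   `𝔓 ∣ v`, fixes exactly a line of `V_ℓ E` — Silverman, *Advanced Topics*, Thm. IV.10.2(a),
   multiplicative case, `codim (V_ℓ E)^{I_𝔓} = 1`, a **theorem** of the tree
   (`WeierstrassCurve.codimFixed_inertia_rationalTate_eq_one_of_hasMultiplicativeReductionAt_holds`,
   `InertiaInvariantsMultiplicativeProofs`; in print via the Tate curve, *ATAEC* V.5.3).
3. **`ord_v(j(E)) < 0` at a finite place `v ∤ ℓ`** (potentially multiplicative reduction, any
   residue characteristic): a quadratic twist `E^{(d)}` has multiplicative reduction at `v` (the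
   Tate form of invariant `j(E)`, *ATAEC* V.5 Thm. 5.3 with Lemma 5.1, the tree's
   `WeierstrassCurve.exists_hasMultiplicativeReductionAt_quadraticTwist_of_one_lt_valuation_j`;
   for `v ∤ 6ℓ` also *AEC* VII.5.5, `WeierstrassCurve.exists_hasMultiplicativeReductionAt_quadraticTwist`),
   its inertia acts unipotently and non-trivially, hence still non-trivially on the index-`≤ 2`
   subgroup `H = I_𝔓 ∩ Γ_{K(√d)}` (`ρ(σ)² = 1` and `ρ(σ)` unipotent force `ρ(σ) = 1`), and
   `E ≅ E^{(d)}` over `K(√d)` (`WeierstrassCurve.finrank_tateModule_fixedPoints_quadraticTwist_eq`,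
   `TateModuleTwistTransportProofs`) transports the line `(V_ℓ E^{(d)})^H` to `(V_ℓ E)^H`.

Cases 2–3 are the `ℓ`-adic shadow of Serre's original argument for curves with non-integral `j`
(1968, IV.2.2 with Appendix A.1: the Tate curve makes inertia act through a non-trivial
unipotent, which no non-split Cartan subgroup contains). In all cases the hypothesis
`End_K(E) = ℤ` is not used. What remains open in the tree is the core fact for a totally
imaginary `K` and a pair `(E, ℓ)` such that `j(E)` is integral at every place `v ∤ ℓ`: there
Serre's proof needs the local algebraicity of abelian semisimple rational `ℓ`-adic
representations (Tate's Hodge–Tate decomposition, 1968 Ch. III; 1972 for integral `j`) and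
Faltings' proof needs Sätze 1–2 for the abelian surfaces `(E × E)/G_n`; at a place `v ∣ ℓ` with
`ord_v(j) < 0` the same unipotent would come from the Tate curve at `ℓ`, which the tree does not
have.

## Contents (all proved; no definitions, no new named facts)

* Linear algebra in a plane over a field: `finrank_ker_sub_one_eq_one_of_mul_self_eq_one` (an
  involution of determinant `-1 ≠ 1` fixes exactly a line),
  `exists_eq_smul_one_of_forall_commute_of_fixed_line` (a family with no stable line and a subset
  fixing exactly a line has scalar commutant), `exists_eq_smul_one_of_forall_commute_of_det_eq_neg_one`
  (the involution case).
* `rationalGaloisRepTate_mul_self_of_isComplexConjugation`,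
  `det_rationalGaloisRepTate_of_isComplexConjugation`: `ρ_ℓ(c)² = 1`, `det ρ_ℓ(c) = -1` on `V_ℓ E`.
* `exists_eq_smul_one_of_equivariant_of_codimFixed_eq_one`: a subgroup `H ≤ Γ_K` with
  `codim (V_ℓ E)^H = 1` makes the commutant of an irreducible `V_ℓ E` scalar.
* `exists_codimFixed_eq_one_of_hasMultiplicativeReductionAt_quadraticTwist`: for a twist
  `E^{(d)}` multiplicative at `v ∤ ℓ`, such an `H` exists (`I_𝔓 ∩ Γ_{K(√d)}`);
  `exists_codimFixed_eq_one_of_one_lt_valuation_j` (`v ∤ 6ℓ`) and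
  `exists_codimFixed_eq_one_of_one_lt_valuation_j'` (`v ∤ ℓ`): hence for `ord_v(j) < 0`.
* `exists_eq_smul_one_of_equivariant_of_realEmbedding`,
  `exists_eq_smul_one_of_equivariant_of_hasMultiplicativeReductionAt`,
  `exists_eq_smul_one_of_equivariant_of_one_lt_valuation_j` (primed form: `v ∤ ℓ` only):
  `End_{Γ_K}(V_ℓ E) = ℚ_ℓ` for irreducible `V_ℓ E` in the three cases (no hypothesis on
  `End_K(E)`).
* `exists_eq_smul_one_of_equivariant_of_not_hasRationalCM_of_realEmbedding`, `…_rat`,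
  `…_of_hasMultiplicativeReductionAt`, `…_of_one_lt_valuation_j`, `…_of_one_lt_valuation_j'`: the
  named core fact in the three cases.
* `mem_span_range_tateEndRingHom_iff_of_realEmbedding`, `…_rat`, `…_of_hasMultiplicativeReductionAt`,
  `…_of_one_lt_valuation_j`: **Faltings' Satz 4 for `E`** (`End_K(E) ⊗ ℤ_ℓ ≅ End_{Γ_K}(T_ℓ E)`),
  unconditionally, over a number field with a real place, resp. for a curve with a multiplicative
  place `v ∤ ℓ`, resp. with `ord_v(j) < 0` at some `v ∤ 6ℓ` (primed form: at some `v ∤ ℓ`).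
* `stable_subspace_prod_eq_range_of_realEmbedding`, `…_rat`, `…_of_hasMultiplicativeReductionAt`,
  `…_of_one_lt_valuation_j`, `…_of_one_lt_valuation_j'`: Faltings' subspace statement for `E × E`
  in the three cases.
* `mem_span_range_tateModule_map_of_equivariant_self_of_realEmbedding`, `…_rat`,
  `…_of_hasMultiplicativeReductionAt`, `…_of_one_lt_valuation_j`, `…_of_one_lt_valuation_j'`:
  Faltings' Korollar 1 for the pair `(E, E)` in the three cases.

## References

* [Faltings1983Endlichkeit] G. Faltings, Invent. Math. 73 (1983), 349–366, §5 Satz 4 and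
  Korollar 1; Engl. transl. in Cornell–Silverman (eds.), *Arithmetic Geometry* (1986), Ch. II §5
  (held copy `book:cornellnd-arithmetic-geometry`, PDF pp. 89–90; read).
* [Serre1968] J.-P. Serre, *Abelian ℓ-adic representations and elliptic curves*, Benjamin 1968,
  Ch. I §1.2 (`χ_ℓ(c) = -1`), Ch. IV §2.2 and Appendix A.1 (the image of `ρ_ℓ` for a non-CM
  curve; the case of non-integral `j` through the Tate curve).
* [SilvermanAEC2009] J. H. Silverman, *The Arithmetic of Elliptic Curves*, 2nd ed., Prop. III.8.1,
  Prop. III.8.3 (`det ρ_ℓ = χ_ℓ`), Prop. VII.5.5, Thm. IX.6.1, Cor. IX.6.2, X.5 Cor. 5.4.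
* [SilvermanATAEC1994] J. H. Silverman, *Advanced Topics in the Arithmetic of Elliptic Curves*,
  Thm. IV.10.2(a),(b) and their proof (PDF pp. 358–362); V.5 Lemma 5.1 and Thm. 5.3 (the Tate
  curve and its twists).

## Design

Theorems only; `noncomputable section`; one universe `u`; base field `K : Type u` with the
instance hypotheses `[NumberField K] [W.IsElliptic]` quantified inside the named facts, as in
`FaltingsECEndCore`; the real place enters as an explicit `φ : K →+* ℝ` (for `K = ℚ`:
`Rat.castHom ℝ`), the multiplicative place as `v : HeightOneSpectrum (𝓞 K)` with
`(ℓ : 𝓞 K) ∉ v.asIdeal` and `W.HasMultiplicativeReductionAt v`, as in `HasseWeilAbelianConductor`,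
and non-integral `j` as `1 < v.valuation K W.j` (with `v.valuation K 2 = 1`,
`v.valuation K 3 = 1` in the unprimed forms, as in `QuadraticTwistMultiplicativeReductionProofs`;
without them in the primed forms, as in `QuadraticTwistTateFormProofs`).
The linear algebra is stated for a plain family `ρ : G → Module.End F V`, as in
`FaltingsECEndCoreProofs`, with which the file composes.
-/

noncomputable section

open scoped TensorProduct

universe u

namespace Literature.AlgebraicGeometry.Motives

/-! ## Linear algebra: an odd involution of a plane -/

section TwoDim

open Module

variable {F V G : Type*} [Field F] [AddCommGroup V] [Module F V]

/-- **An involution of determinant `-1` of a plane fixes exactly a line.** Over a field with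
`-1 ≠ 1`, if `dim V = 2`, `t² = 1` and `det t = -1`, then `ker (t - 1)` is a line: it is not all
of `V` (else `t = 1`, `det t = 1`) and not `0` (else `t - 1` is injective and
`(t - 1)(t + 1) = t² - 1 = 0` forces `t = -1`, `det t = (-1)² = 1`). [folklore] -/
theorem finrank_ker_sub_one_eq_one_of_mul_self_eq_one (h2 : finrank F V = 2) (h11 : (-1 : F) ≠ 1)
    {t : Module.End F V} (ht : t * t = 1) (hdet : LinearMap.det t = -1) :
    finrank F (LinearMap.ker (t - 1)) = 1 := by
  haveI : Module.Finite F V := Module.finite_of_finrank_eq_succ h2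
  set L := LinearMap.ker (t - 1) with hL
  have htop : L ≠ ⊤ := by
    intro htop
    have h1 : t = 1 := by
      have h0 : t - 1 = 0 := LinearMap.ker_eq_top.mp htop
      exact sub_eq_zero.mp h0
    rw [h1, map_one] at hdet
    exact h11 hdet.symm
  have hbot : L ≠ ⊥ := by
    intro hbot
    have hneg : t = -1 := by
      refine LinearMap.ext fun v ↦ ?_
      have hv : (t - 1) ((t + 1) v) = 0 := by
        rw [← Module.End.mul_apply, show (t - 1) * (t + 1) = 0 by noncomm_ring [ht]]
        rfl
      have hmem : (t + 1) v ∈ L := hv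
      rw [hbot, Submodule.mem_bot] at hmem
      rw [LinearMap.neg_apply, eq_neg_iff_add_eq_zero]
      exact hmem
    have hsmul : (-1 : Module.End F V) = (-1 : F) • (1 : Module.End F V) := by
      rw [neg_smul, one_smul]
    rw [hneg, hsmul, LinearMap.det_smul, map_one, mul_one, h2, neg_one_sq] at hdet
    exact h11 hdet.symm
  have hle : finrank F L ≤ 2 := h2 ▸ Submodule.finrank_le L
  have hne0 : finrank F L ≠ 0 := fun h0 ↦ hbot (Submodule.finrank_eq_zero.mp h0)
  have hne2 : finrank F L ≠ 2 := fun h ↦ htop (Submodule.eq_top_of_finrank_eq (h.trans h2.symm))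
  omega

/-- **A subset fixing exactly a line makes the commutant of an irreducible family scalar.**
Let `V` be a plane over a field, `ρ : G → End(V)` a family leaving no line stable, and `S ⊆ G`
a subset whose common fixed space `L = {v | ∀ s ∈ S, ρ s v = v}` is a line. Then every
endomorphism `s` commuting with all `ρ g` is a scalar: otherwise the `ρ g` commute pairwise
(`commute_of_forall_commute_of_not_exists_eq_smul_one`: they lie in `F + F s`), so `L` is
`ρ`-stable — a stable line. This is the linear algebra of "an abelian image lies in a non-split
Cartan subgroup, whose non-trivial elements fix no line" (Serre 1968, Ch. IV, §2.2). [folklore] -/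
theorem exists_eq_smul_one_of_forall_commute_of_fixed_line (h2 : finrank F V = 2)
    (ρ : G → Module.End F V) (S : Set G) {L : Submodule F V}
    (hL : ∀ v : V, v ∈ L ↔ ∀ g ∈ S, ρ g v = v) (hL1 : finrank F L = 1)
    (hnl : ∀ L : Submodule F V, (∀ g : G, ∀ v ∈ L, ρ g v ∈ L) → finrank F L ≠ 1)
    {s : Module.End F V} (hs : ∀ g, s * ρ g = ρ g * s) : ∃ a : F, s = a • 1 := by
  by_contra hns
  have hcomm := commute_of_forall_commute_of_not_exists_eq_smul_one h2 ρ hs hns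
  refine hnl L (fun g v hv ↦ ?_) hL1
  rw [hL] at hv ⊢
  intro t ht
  rw [← Module.End.mul_apply, hcomm t g, Module.End.mul_apply, hv t ht]

/-- **An odd involution in an abelian image forbids irreducibility.** Let `V` be a plane over a
field with `-1 ≠ 1` and `ρ : G → End(V)` a family containing `ρ c` with `(ρ c)² = 1` and
`det (ρ c) = -1`, such that no line of `V` is stable under all `ρ g`. Then every endomorphism `s`
commuting with all `ρ g` is a scalar: `exists_eq_smul_one_of_forall_commute_of_fixed_line` for
`S = {c}`, whose fixed space `ker (ρ c - 1)` is a line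
(`finrank_ker_sub_one_eq_one_of_mul_self_eq_one`). This is the linear algebra of "a complex
conjugation does not lie in a non-split Cartan subgroup" (Serre 1968, Ch. IV, §2.2). [folklore] -/
theorem exists_eq_smul_one_of_forall_commute_of_det_eq_neg_one (h2 : finrank F V = 2)
    (h11 : (-1 : F) ≠ 1) (ρ : G → Module.End F V) {c : G} (hc : ρ c * ρ c = 1)
    (hdet : LinearMap.det (ρ c) = -1)
    (hnl : ∀ L : Submodule F V, (∀ g : G, ∀ v ∈ L, ρ g v ∈ L) → finrank F L ≠ 1)
    {s : Module.End F V} (hs : ∀ g, s * ρ g = ρ g * s) : ∃ a : F, s = a • 1 := by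
  refine exists_eq_smul_one_of_forall_commute_of_fixed_line h2 ρ {c}
    (L := LinearMap.ker (ρ c - 1)) (fun v ↦ ?_)
    (finrank_ker_sub_one_eq_one_of_mul_self_eq_one h2 h11 hc hdet) hnl hs
  rw [LinearMap.mem_ker, LinearMap.sub_apply, Module.End.one_apply, sub_eq_zero]
  simp only [Set.mem_singleton_iff, forall_eq]

end TwoDim

/-! ## A complex conjugation acts on `V_ℓ E` as an odd involution -/

open WeierstrassCurve Literature.NumberTheory.GaloisRepresentations
open Literature.NumberTheory.EllipticCurves IsDedekindDomain
open scoped NumberField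

variable {K : Type u} [Field K] (W : WeierstrassCurve K) (ℓ : ℕ) [Fact ℓ.Prime]

/-- For a complex conjugation `c ∈ Γ_K` (attached to a real embedding `φ : K →+* ℝ`),
`ρ_ℓ(c)² = 1` on `V_ℓ E`: `c² = 1` in `Γ_K` (`IsComplexConjugation.sq_eq_one`) and `ρ_ℓ` is a
homomorphism. [folklore] -/
theorem rationalGaloisRepTate_mul_self_of_isComplexConjugation {φ : K →+* ℝ}
    {c : Field.absoluteGaloisGroup K} (hc : IsComplexConjugation φ c) :
    rationalGaloisRepTate W ℓ c * rationalGaloisRepTate W ℓ c = 1 := by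
  rw [← map_mul, ← pow_two, hc.sq_eq_one, map_one]

/-- **`det ρ_ℓ(c) = -1` on `V_ℓ E` for a complex conjugation `c`.** For an elliptic curve `E`
over a field `K` with a real embedding `φ : K →+* ℝ` (so `char K = 0`), a prime `ℓ` and a
complex conjugation `c ∈ Γ_K` for `φ`: `det ρ_ℓ(c) = χ_ℓ(c) = -1`. Ingredients: the Weil pairing
(`exists_weilPairing_holds`, *AEC* III.8.1) gives `det ρ_ℓ = χ_ℓ` on `T_ℓ E`
(`det_galoisRepTate_eq_cyclotomicCharacter`, *AEC* III.8.3), `det` commutes with `ℚ_ℓ ⊗ -`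
(`LinearMap.det_baseChange`), and `χ_ℓ(c) = -1`
(`GaloisRep.cyclotomicCharacter_of_isComplexConjugation`, Serre 1968, I.1.2).
[cite: SilvermanAEC2009, Prop. III.8.3] -/
theorem det_rationalGaloisRepTate_of_isComplexConjugation [W.IsElliptic] {φ : K →+* ℝ}
    {c : Field.absoluteGaloisGroup K} (hc : IsComplexConjugation φ c) :
    LinearMap.det (rationalGaloisRepTate W ℓ c :
      W.rationalTateModule ℓ →ₗ[ℚ_[ℓ]] W.rationalTateModule ℓ) = -1 := by
  haveI : CharZero K := charZero_of_realEmbedding φ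
  haveI : PerfectField K := PerfectField.ofCharZero
  have hℓK : (ℓ : K) ≠ 0 := Nat.cast_ne_zero.mpr (Fact.out : ℓ.Prime).ne_zero
  haveI := module_free_tateModule_holds W ℓ
  haveI := module_finite_tateModule_holds W ℓ
  change LinearMap.det ((W.galoisRepTate ℓ c).baseChange ℚ_[ℓ]) = -1
  rw [LinearMap.det_baseChange, det_galoisRepTate_eq_cyclotomicCharacter W ℓ hℓK
    (fun n ↦ exists_weilPairing_holds W (ℓ ^ (n + 1))) c,
    GaloisRep.cyclotomicCharacter_of_isComplexConjugation ℓ hc, map_neg, map_one]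

/-! ## A subgroup of `Γ_K` fixing exactly a line of `V_ℓ E` -/

/-- **`End_{Γ_K}(V_ℓ E) = ℚ_ℓ` for irreducible `V_ℓ E` once some subgroup of `Γ_K` fixes
exactly a line.** For an elliptic curve `E/K`, a prime `ℓ ≠ char K` and a subgroup `H ≤ Γ_K`
with `codim (V_ℓ E)^H = 1` (so `(V_ℓ E)^H` is a line of the plane `V_ℓ E`,
`finrank_rationalTateModule_eq_two_holds`): if `V_ℓ E` has no `Γ_K`-stable `ℚ_ℓ`-line, every
`Γ_K`-equivariant endomorphism of `V_ℓ E` is a scalar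
(`exists_eq_smul_one_of_forall_commute_of_fixed_line` with `S = H`). [folklore] -/
theorem exists_eq_smul_one_of_equivariant_of_codimFixed_eq_one [W.IsElliptic]
    (hℓK : (ℓ : K) ≠ 0)
    (h : Continuous fun x : Field.absoluteGaloisGroup K × RationalTateModule (geomPoints W) ℓ ↦
      rationalTateRepresentation (Field.absoluteGaloisGroup K) (geomPoints W) ℓ x.1 x.2)
    (H : Subgroup (Field.absoluteGaloisGroup K))
    (hH : (rationalTateGaloisRepOf (geomPoints W) ℓ h).codimFixed H = 1)
    (hnl : ∀ L : Submodule ℚ_[ℓ] (W.rationalTateModule ℓ),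
      (∀ σ : Field.absoluteGaloisGroup K, ∀ v ∈ L, rationalGaloisRepTate W ℓ σ v ∈ L) →
        Module.finrank ℚ_[ℓ] L ≠ 1)
    (G : Module.End ℚ_[ℓ] (W.rationalTateModule ℓ))
    (hG : ∀ (σ : Field.absoluteGaloisGroup K) (v : W.rationalTateModule ℓ),
      G (rationalGaloisRepTate W ℓ σ v) = rationalGaloisRepTate W ℓ σ (G v)) :
    ∃ c : ℚ_[ℓ], G = c • 1 := by
  have h2 : Module.finrank ℚ_[ℓ] (RationalTateModule (geomPoints W) ℓ) = 2 :=
    finrank_rationalTateModule_eq_two_holds W ℓ hℓK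
  haveI : Module.Finite ℚ_[ℓ] (RationalTateModule (geomPoints W) ℓ) :=
    module_finite_rationalTateModule_holds W ℓ
  have hL1 : Module.finrank ℚ_[ℓ]
      ((rationalTateGaloisRepOf (geomPoints W) ℓ h).fixedSubmodule H) = 1 := by
    rw [ContinuousRep.codimFixed_eq_finrank_sub, h2] at hH
    have hle := Submodule.finrank_le ((rationalTateGaloisRepOf (geomPoints W) ℓ h).fixedSubmodule H)
    rw [h2] at hle
    omega
  refine exists_eq_smul_one_of_forall_commute_of_fixed_line h2
    (fun σ ↦ rationalGaloisRepTate W ℓ σ) (H : Set (Field.absoluteGaloisGroup K))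
    (L := (rationalTateGaloisRepOf (geomPoints W) ℓ h).fixedSubmodule H) (fun w ↦ ?_) hL1 hnl
    fun σ ↦ LinearMap.ext fun w ↦ hG σ w
  rw [ContinuousRep.mem_fixedSubmodule]
  rfl

/-! ## A twist multiplicative at `v ∤ ℓ`: inertia within `Γ_{K(√d)}` fixes exactly a line -/

/-- **A quadratic twist with multiplicative reduction: a line of `V_ℓ E` fixed by
`I_𝔓 ∩ Γ_{K(√d)}`.** Let `E/K` be an elliptic curve over a number field, `ℓ` a prime, `v ∤ ℓ` a
finite place (any residue characteristic), `d ∈ K^*` such that the quadratic twist `E^{(d)}` has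
multiplicative reduction at `v`, and `𝔓 ∣ v` a prime of `\bar ℤ_K`. Then
`codim (V_ℓ E^{(d)})^{I_𝔓} = 1` (*ATAEC* Thm. IV.10.2(a), multiplicative case, the tree's theorem
`codimFixed_inertia_rationalTate_eq_one_of_hasMultiplicativeReductionAt_holds`), and for
`H = I_𝔓 ∩ Γ_{K(√d)}` also `codim (V_ℓ E^{(d)})^{H} = 1`: it is `≤ 1`, and were `H` to act
trivially, every `σ ∈ I_𝔓` would satisfy `ρ(σ)² = ρ(σ²) = 1` (`σ² ∈ Γ_{K(√d)}` as
`σ√d = ±√d`, `map_geomSqrt`) while acting unipotently (`det ρ(σ) = χ_ℓ(σ) = 1`,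
`det_rationalTateRepresentation_eq_one_of_mem_inertia`, and a fixed non-zero vector,
`exists_ne_zero_fixed_of_codimFixed_le_one`, `LinearMap.sub_mem_span_of_det_eq_one`), whence
`ρ(σ) = 1` on `V_ℓ E^{(d)}` — contradicting `codim = 1`. Finally `E ≅ E^{(d)}` over `K(√d)`
transports `H`-invariants (`finrank_tateModule_fixedPoints_quadraticTwist_eq`,
`codimFixed_rationalTate_eq_two_sub`): `codim (V_ℓ E)^{H} = 1`. This is the Galois shadow of
Serre's use of the Tate curve for curves with non-integral `j` (1968, IV.2.2 and A.1).
[cite: SilvermanATAEC1994, Thm. IV.10.2(a),(b), case v(j) < 0 (PDF pp. 358–360)] -/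
theorem exists_codimFixed_eq_one_of_hasMultiplicativeReductionAt_quadraticTwist [NumberField K]
    [W.IsElliptic]
    (h : Continuous fun x : Field.absoluteGaloisGroup K × RationalTateModule (geomPoints W) ℓ ↦
      rationalTateRepresentation (Field.absoluteGaloisGroup K) (geomPoints W) ℓ x.1 x.2)
    {v : HeightOneSpectrum (𝓞 K)} (hℓv : (ℓ : 𝓞 K) ∉ v.asIdeal) {d : K} (hd : d ≠ 0)
    (hX : (W.quadraticTwist d).HasMultiplicativeReductionAt v) :
    ∃ H : Subgroup (Field.absoluteGaloisGroup K),
      (rationalTateGaloisRepOf (geomPoints W) ℓ h).codimFixed H = 1 := by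
  have hℓK : ((ℓ : ℕ) : K) ≠ 0 := Nat.cast_ne_zero.mpr (Fact.out : ℓ.Prime).ne_zero
  haveI hXell : (W.quadraticTwist d).IsElliptic := W.isElliptic_quadraticTwist hd
  have hcX : Continuous fun x : Field.absoluteGaloisGroup K ×
      RationalTateModule (geomPoints (W.quadraticTwist d)) ℓ ↦
        rationalTateRepresentation (Field.absoluteGaloisGroup K) (geomPoints (W.quadraticTwist d))
          ℓ x.1 x.2 :=
    continuous_rationalGaloisRepTate_holds (W.quadraticTwist d) ℓ
  haveI : Module.Finite ℚ_[ℓ] (RationalTateModule (geomPoints (W.quadraticTwist d)) ℓ) :=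
    module_finite_rationalTateModule_holds (W.quadraticTwist d) ℓ
  have h2X : Module.finrank ℚ_[ℓ] (RationalTateModule (geomPoints (W.quadraticTwist d)) ℓ) = 2 :=
    finrank_rationalTateModule_eq_two_holds (W.quadraticTwist d) ℓ hℓK
  obtain ⟨𝔓, h𝔓⟩ := HeightOneSpectrum.primesAbove_nonempty v
  set I : Subgroup (Field.absoluteGaloisGroup K) := 𝔓.inertia (Field.absoluteGaloisGroup K)
    with hIdef
  set N : Subgroup (Field.absoluteGaloisGroup K) :=
    MulAction.stabilizer (Field.absoluteGaloisGroup K) (geomSqrt d) with hNdef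
  set R := rationalTateGaloisRepOf (geomPoints (W.quadraticTwist d)) ℓ hcX with hRdef
  -- (1) `codim (V_ℓ E^{(d)})^{I_𝔓} = 1`
  have hI : R.codimFixed I = 1 :=
    codimFixed_inertia_rationalTate_eq_one_of_hasMultiplicativeReductionAt_holds
      (W.quadraticTwist d) ℓ hcX v hℓv hX h𝔓
  -- (2) inertia acts unipotently on `V_ℓ E^{(d)}`
  obtain ⟨e, he0, he⟩ :=
    exists_ne_zero_fixed_of_codimFixed_le_one (W.quadraticTwist d) ℓ hcX I hI.le
  have hunip : ∀ σ ∈ I, ∀ w : RationalTateModule (geomPoints (W.quadraticTwist d)) ℓ,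
      R σ (R σ w - w) = R σ w - w := by
    intro σ hσ w
    have hdet := det_rationalTateRepresentation_eq_one_of_mem_inertia (W.quadraticTwist d) ℓ
      (fun n ↦ exists_weilPairing_holds (W.quadraticTwist d) (ℓ ^ (n + 1))) hℓv h𝔓 hσ
    obtain ⟨a, ha⟩ := Submodule.mem_span_singleton.mp
      (LinearMap.sub_mem_span_of_det_eq_one h2X _ he0 (he σ hσ) hdet w)
    have hRσ : ∀ u, R σ u = rationalTateRepresentation (Field.absoluteGaloisGroup K)
        (geomPoints (W.quadraticTwist d)) ℓ σ u := fun u ↦ rfl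
    simp only [hRσ]
    rw [← ha, map_smul, he σ hσ]
  -- (3) `codim (V_ℓ E^{(d)})^{I ⊓ N} = 1`
  have hIN : R.codimFixed (I ⊓ N) = 1 := by
    have hle : R.codimFixed (I ⊓ N) ≤ 1 := by
      rw [← hI, ContinuousRep.codimFixed_eq_finrank_sub, ContinuousRep.codimFixed_eq_finrank_sub]
      have := Submodule.finrank_mono (R.fixedSubmodule_antitone (inf_le_left : I ⊓ N ≤ I))
      omega
    have hne : R.codimFixed (I ⊓ N) ≠ 0 := by
      intro h0
      rw [ContinuousRep.codimFixed_eq_zero_iff] at h0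
      -- every `σ ∈ I` then acts trivially: `ρ(σ)² = 1` and `ρ(σ)` unipotent
      have htriv : ∀ σ ∈ I, R σ = 1 := by
        intro σ hσ
        have hσ2 : σ * σ ∈ I ⊓ N := by
          refine ⟨I.mul_mem hσ hσ, ?_⟩
          change σ * σ ∈ MulAction.stabilizer (Field.absoluteGaloisGroup K) (geomSqrt d)
          rw [MulAction.mem_stabilizer_iff, mul_smul]
          rcases map_geomSqrt (Field.absoluteGaloisGroup.toAlgEquiv K σ) d with h1 | h1 <;>
            rw [← Field.absoluteGaloisGroup.smul_def] at h1
          · rw [h1, h1]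
          · rw [h1, smul_neg, h1, neg_neg]
        have hsq : R σ * R σ = 1 := by rw [← map_mul]; exact h0 _ hσ2
        refine LinearMap.ext fun w ↦ ?_
        -- `w = ρ(σ)(ρ(σ) w) = ρ(σ) w + (ρ(σ) w - w)`, so `2 (ρ(σ) w - w) = 0`
        have h1 : R σ (R σ w) = w := by
          rw [← Module.End.mul_apply, hsq, Module.End.one_apply]
        have h3 := hunip σ hσ w
        rw [map_sub, h1] at h3
        have h4 : (2 : ℚ_[ℓ]) • w = (2 : ℚ_[ℓ]) • R σ w := by
          rw [two_smul, two_smul]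
          exact sub_eq_sub_iff_add_eq_add.mp h3
        have h5 := smul_right_injective (RationalTateModule (geomPoints (W.quadraticTwist d)) ℓ)
          (two_ne_zero : (2 : ℚ_[ℓ]) ≠ 0) h4
        rw [Module.End.one_apply]
        exact h5.symm
      have : R.codimFixed I = 0 := R.codimFixed_eq_zero_of_forall_eq_one htriv
      omega
    omega
  -- (4) transport to `E` along `E ≅ E^{(d)}` over `K(√d)`
  refine ⟨I ⊓ N, ?_⟩
  rw [(W.quadraticTwist d).codimFixed_rationalTate_eq_two_sub ℓ hℓK hcX (I ⊓ N),
    W.finrank_tateModule_fixedPoints_quadraticTwist_eq hd ℓ (H := I ⊓ N) inf_le_right] at hIN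
  rw [W.codimFixed_rationalTate_eq_two_sub ℓ hℓK h (I ⊓ N)]
  exact hIN

/-! ## At a place `v ∤ ℓ` with `ord_v(j) < 0`, inertia within `Γ_{K(√d)}` fixes exactly a line -/

/-- **Potentially multiplicative reduction at `v ∤ 6ℓ`: a line of `V_ℓ E` fixed by
`I_𝔓 ∩ Γ_{K(√d)}`.** Let `E/K` be an elliptic curve over a number field, `ℓ` a prime, `v ∤ ℓ` a
finite place of residue characteristic `≠ 2, 3` (`v(2) = v(3) = 0`) with `ord_v(j(E)) < 0`. By
Silverman, *AEC*, VII.5.5 (tree: `exists_hasMultiplicativeReductionAt_quadraticTwist`, through the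
short model, whence `v ∤ 6`) some quadratic twist `E^{(d)}` has multiplicative reduction at `v`,
and `exists_codimFixed_eq_one_of_hasMultiplicativeReductionAt_quadraticTwist` applies. Superseded
by `exists_codimFixed_eq_one_of_one_lt_valuation_j'` (any residue characteristic); kept for its
users. [cite: SilvermanATAEC1994, Thm. IV.10.2(a),(b), case v(j) < 0 (PDF pp. 358–360)] -/
theorem exists_codimFixed_eq_one_of_one_lt_valuation_j [NumberField K] [W.IsElliptic]
    (h : Continuous fun x : Field.absoluteGaloisGroup K × RationalTateModule (geomPoints W) ℓ ↦
      rationalTateRepresentation (Field.absoluteGaloisGroup K) (geomPoints W) ℓ x.1 x.2)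
    {v : HeightOneSpectrum (𝓞 K)} (hℓv : (ℓ : 𝓞 K) ∉ v.asIdeal)
    (hv2 : v.valuation K (2 : K) = 1) (hv3 : v.valuation K (3 : K) = 1)
    (hj : 1 < v.valuation K W.j) :
    ∃ H : Subgroup (Field.absoluteGaloisGroup K),
      (rationalTateGaloisRepOf (geomPoints W) ℓ h).codimFixed H = 1 := by
  obtain ⟨d, hd, -, hX⟩ := exists_hasMultiplicativeReductionAt_quadraticTwist v W hv2 hv3 hj
  exact exists_codimFixed_eq_one_of_hasMultiplicativeReductionAt_quadraticTwist W ℓ h hℓv hd hX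

/-- **Potentially multiplicative reduction at `v ∤ ℓ`, any residue characteristic: a line of
`V_ℓ E` fixed by `I_𝔓 ∩ Γ_{K(√d)}`.** Let `E/K` be an elliptic curve over a number field, `ℓ` a
prime and `v ∤ ℓ` a finite place with `ord_v(j(E)) < 0` (`1 < v.valuation K W.j`; residue
characteristics `2` and `3` allowed). Some quadratic twist `E^{(d)}` has multiplicative reduction
at `v` — Silverman, *ATAEC*, V.5 Thm. 5.3 with Lemma 5.1 in Tate-form shape: `E` is a quadratic
twist of the `v`-integral curve `y² + xy = x³ - 36x/(j - 1728) - 1/(j - 1728)` of invariant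
`j = j(E)`, which has multiplicative reduction at `v` in every residue characteristic (the tree's
theorem `WeierstrassCurve.exists_hasMultiplicativeReductionAt_quadraticTwist_of_one_lt_valuation_j`,
`QuadraticTwistTateFormProofs`) — and
`exists_codimFixed_eq_one_of_hasMultiplicativeReductionAt_quadraticTwist` applies: some subgroup
`H ≤ Γ_K` has `codim (V_ℓ E)^H = 1`.
[cite: SilvermanATAEC1994, V.5 Thm. 5.3 with Lemma 5.1; Thm. IV.10.2(a), multiplicative case (PDF pp. 358–360)] -/
theorem exists_codimFixed_eq_one_of_one_lt_valuation_j' [NumberField K] [W.IsElliptic]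
    (h : Continuous fun x : Field.absoluteGaloisGroup K × RationalTateModule (geomPoints W) ℓ ↦
      rationalTateRepresentation (Field.absoluteGaloisGroup K) (geomPoints W) ℓ x.1 x.2)
    {v : HeightOneSpectrum (𝓞 K)} (hℓv : (ℓ : 𝓞 K) ∉ v.asIdeal) (hj : 1 < v.valuation K W.j) :
    ∃ H : Subgroup (Field.absoluteGaloisGroup K),
      (rationalTateGaloisRepOf (geomPoints W) ℓ h).codimFixed H = 1 := by
  obtain ⟨d, hd, hX⟩ :=
    W.exists_hasMultiplicativeReductionAt_quadraticTwist_of_one_lt_valuation_j v hj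
  exact exists_codimFixed_eq_one_of_hasMultiplicativeReductionAt_quadraticTwist W ℓ h hℓv hd hX

/-! ## The core fact, Satz 4 and the subspace statement in the three cases -/

/-- **`End_{Γ_K}(V_ℓ E) = ℚ_ℓ` for irreducible `V_ℓ E` when `E` has a multiplicative place
`v ∤ ℓ`.** Let `K` be a number field, `E/K` an elliptic curve with multiplicative reduction at
the finite place `v` (`W.HasMultiplicativeReductionAt v`), and `ℓ` a prime with `v ∤ ℓ` such that
`V_ℓ E` has no `Γ_K`-stable `ℚ_ℓ`-line. Then every `Γ_K`-equivariant `ℚ_ℓ`-linear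
endomorphism `G` of `V_ℓ E` is a scalar: the inertia group `I_𝔓` at a prime `𝔓 ∣ v`
(`HeightOneSpectrum.primesAbove_nonempty`) fixes exactly a line of `V_ℓ E` — Silverman,
*ATAEC*, Thm. IV.10.2(a), multiplicative case, `codim (V_ℓ E)^{I_𝔓} = 1`, a theorem of the tree
(`codimFixed_inertia_rationalTate_eq_one_of_hasMultiplicativeReductionAt_holds`, with the
continuity `continuous_rationalGaloisRepTate_holds`) — and
`exists_eq_smul_one_of_equivariant_of_codimFixed_eq_one` applies. (Serre 1968, Ch. IV, §2.2 with
A.1.5: through the Tate curve, the image of inertia at a place of multiplicative reduction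
contains a non-trivial unipotent, which no non-split Cartan subgroup does.) No hypothesis on
`End_K(E)` is needed.
[cite: Faltings1983Endlichkeit, §5 Satz 4 (⊗ ℚ_ℓ form; case of a multiplicative place)] -/
theorem exists_eq_smul_one_of_equivariant_of_hasMultiplicativeReductionAt [NumberField K]
    [W.IsElliptic] {v : HeightOneSpectrum (𝓞 K)} (hℓv : (ℓ : 𝓞 K) ∉ v.asIdeal)
    (hv : W.HasMultiplicativeReductionAt v)
    (hnl : ∀ L : Submodule ℚ_[ℓ] (W.rationalTateModule ℓ),
      (∀ σ : Field.absoluteGaloisGroup K, ∀ v ∈ L, rationalGaloisRepTate W ℓ σ v ∈ L) →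
        Module.finrank ℚ_[ℓ] L ≠ 1)
    (G : Module.End ℚ_[ℓ] (W.rationalTateModule ℓ))
    (hG : ∀ (σ : Field.absoluteGaloisGroup K) (v : W.rationalTateModule ℓ),
      G (rationalGaloisRepTate W ℓ σ v) = rationalGaloisRepTate W ℓ σ (G v)) :
    ∃ c : ℚ_[ℓ], G = c • 1 := by
  have hℓK : ((ℓ : ℕ) : K) ≠ 0 := Nat.cast_ne_zero.mpr (Fact.out : ℓ.Prime).ne_zero
  have hcont : Continuous fun x : Field.absoluteGaloisGroup K × RationalTateModule (geomPoints W) ℓ ↦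
      rationalTateRepresentation (Field.absoluteGaloisGroup K) (geomPoints W) ℓ x.1 x.2 :=
    continuous_rationalGaloisRepTate_holds W ℓ
  obtain ⟨𝔓, h𝔓⟩ := HeightOneSpectrum.primesAbove_nonempty v
  exact exists_eq_smul_one_of_equivariant_of_codimFixed_eq_one W ℓ hℓK hcont
    (𝔓.inertia (Field.absoluteGaloisGroup K))
    (codimFixed_inertia_rationalTate_eq_one_of_hasMultiplicativeReductionAt_holds W ℓ hcont v hℓv
      hv h𝔓) hnl G hG

/-- **`End_{Γ_K}(V_ℓ E) = ℚ_ℓ` for irreducible `V_ℓ E` when `ord_v(j(E)) < 0` at a place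
`v ∤ 6ℓ`.** Let `K` be a number field, `E/K` an elliptic curve, `ℓ` a prime and `v ∤ ℓ` a finite
place of residue characteristic `≠ 2, 3` at which `j(E)` is not integral (potentially
multiplicative reduction). If `V_ℓ E` has no `Γ_K`-stable `ℚ_ℓ`-line, every `Γ_K`-equivariant
`ℚ_ℓ`-linear endomorphism of `V_ℓ E` is a scalar: `exists_codimFixed_eq_one_of_one_lt_valuation_j`
(a quadratic twist is multiplicative at `v`; inertia within `Γ_{K(√d)}` fixes exactly a line) and
`exists_eq_smul_one_of_equivariant_of_codimFixed_eq_one`. This is the reach of Serre's 1968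
argument for curves with non-integral `j` (Ch. IV, §2.2 and A.1), read at one prime `ℓ`.
[cite: Faltings1983Endlichkeit, §5 Satz 4 (⊗ ℚ_ℓ form; case ord_v(j) < 0, v ∤ 6ℓ)] -/
theorem exists_eq_smul_one_of_equivariant_of_one_lt_valuation_j [NumberField K]
    [W.IsElliptic] {v : HeightOneSpectrum (𝓞 K)} (hℓv : (ℓ : 𝓞 K) ∉ v.asIdeal)
    (hv2 : v.valuation K (2 : K) = 1) (hv3 : v.valuation K (3 : K) = 1)
    (hj : 1 < v.valuation K W.j)
    (hnl : ∀ L : Submodule ℚ_[ℓ] (W.rationalTateModule ℓ),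
      (∀ σ : Field.absoluteGaloisGroup K, ∀ v ∈ L, rationalGaloisRepTate W ℓ σ v ∈ L) →
        Module.finrank ℚ_[ℓ] L ≠ 1)
    (G : Module.End ℚ_[ℓ] (W.rationalTateModule ℓ))
    (hG : ∀ (σ : Field.absoluteGaloisGroup K) (v : W.rationalTateModule ℓ),
      G (rationalGaloisRepTate W ℓ σ v) = rationalGaloisRepTate W ℓ σ (G v)) :
    ∃ c : ℚ_[ℓ], G = c • 1 := by
  have hℓK : ((ℓ : ℕ) : K) ≠ 0 := Nat.cast_ne_zero.mpr (Fact.out : ℓ.Prime).ne_zero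
  have hcont : Continuous fun x : Field.absoluteGaloisGroup K × RationalTateModule (geomPoints W) ℓ ↦
      rationalTateRepresentation (Field.absoluteGaloisGroup K) (geomPoints W) ℓ x.1 x.2 :=
    continuous_rationalGaloisRepTate_holds W ℓ
  obtain ⟨H, hH⟩ := exists_codimFixed_eq_one_of_one_lt_valuation_j W ℓ hcont hℓv hv2 hv3 hj
  exact exists_eq_smul_one_of_equivariant_of_codimFixed_eq_one W ℓ hℓK hcont H hH hnl G hG

/-- **`End_{Γ_K}(V_ℓ E) = ℚ_ℓ` for irreducible `V_ℓ E` over a number field with a real place.**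
Let `K` be a number field with a real embedding `φ : K →+* ℝ`, `E/K` an elliptic curve and `ℓ` a
prime such that `V_ℓ E` has no `Γ_K`-stable `ℚ_ℓ`-line. Then every `Γ_K`-equivariant
`ℚ_ℓ`-linear endomorphism `G` of `V_ℓ E` is a scalar. Proof: a complex conjugation `c` for `φ`
(`exists_isComplexConjugation`) acts on the plane `V_ℓ E` (`finrank_rationalTateModule_eq_two_holds`)
as an involution of determinant `-1` (`det_rationalGaloisRepTate_of_isComplexConjugation`), and
`exists_eq_smul_one_of_forall_commute_of_det_eq_neg_one` applies. (Serre 1968, Ch. IV, §2.2: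
the image of `Γ_K` is not contained in a non-split Cartan subgroup, as it contains an element
with the two distinct rational eigenvalues `±1`.) No hypothesis on `End_K(E)` is needed: over
such `K` an irreducible `V_ℓ E` is absolutely irreducible. [cite: Faltings1983Endlichkeit, §5 Satz 4 (⊗ ℚ_ℓ form; case of a real place)] -/
theorem exists_eq_smul_one_of_equivariant_of_realEmbedding (φ : K →+* ℝ) [NumberField K]
    [W.IsElliptic]
    (hnl : ∀ L : Submodule ℚ_[ℓ] (W.rationalTateModule ℓ),
      (∀ σ : Field.absoluteGaloisGroup K, ∀ v ∈ L, rationalGaloisRepTate W ℓ σ v ∈ L) →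
        Module.finrank ℚ_[ℓ] L ≠ 1)
    (G : Module.End ℚ_[ℓ] (W.rationalTateModule ℓ))
    (hG : ∀ (σ : Field.absoluteGaloisGroup K) (v : W.rationalTateModule ℓ),
      G (rationalGaloisRepTate W ℓ σ v) = rationalGaloisRepTate W ℓ σ (G v)) :
    ∃ c : ℚ_[ℓ], G = c • 1 := by
  have hℓK : ((ℓ : ℕ) : K) ≠ 0 := Nat.cast_ne_zero.mpr (Fact.out : ℓ.Prime).ne_zero
  have h2 := finrank_rationalTateModule_eq_two_holds W ℓ hℓK
  have h11 : (-1 : ℚ_[ℓ]) ≠ 1 := by norm_num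
  obtain ⟨c, hc⟩ := exists_isComplexConjugation φ
  exact exists_eq_smul_one_of_forall_commute_of_det_eq_neg_one h2 h11
    (fun σ ↦ rationalGaloisRepTate W ℓ σ)
    (rationalGaloisRepTate_mul_self_of_isComplexConjugation W ℓ hc)
    (det_rationalGaloisRepTate_of_isComplexConjugation W ℓ hc) hnl
    fun σ ↦ LinearMap.ext fun v ↦ hG σ v

/-- **The core fact of Satz 4 for `E` over a number field with a real place.** For a field `K`
with a real embedding `φ : K →+* ℝ`, a Weierstrass curve `W` over `K` and a prime `ℓ`, the named
fact `exists_eq_smul_one_of_equivariant_of_not_hasRationalCM W ℓ` (`FaltingsECEndCore`: for `K`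
a number field, `E` elliptic with `End_K(E) = ℤ` and `V_ℓ E` without `Γ_K`-stable line,
`End_{Γ_K}(V_ℓ E) = ℚ_ℓ`) holds — by `exists_eq_smul_one_of_equivariant_of_realEmbedding`, the
hypothesis `End_K(E) = ℤ` being superfluous over such `K`.
[cite: Faltings1983Endlichkeit, §5 Satz 4 (⊗ ℚ_ℓ form; case of a real place)] -/
theorem exists_eq_smul_one_of_equivariant_of_not_hasRationalCM_of_realEmbedding (φ : K →+* ℝ) :
    exists_eq_smul_one_of_equivariant_of_not_hasRationalCM W ℓ :=
  fun _ hnl G hG ↦ exists_eq_smul_one_of_equivariant_of_realEmbedding W ℓ φ hnl G hG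

/-- **The core fact of Satz 4 for a curve with a multiplicative place `v ∤ ℓ`.** For a number
field `K`, a Weierstrass curve `W` over `K` with multiplicative reduction at the finite place
`v` and a prime `ℓ` with `v ∤ ℓ`, the named fact
`exists_eq_smul_one_of_equivariant_of_not_hasRationalCM W ℓ` (`FaltingsECEndCore`) holds — by
`exists_eq_smul_one_of_equivariant_of_hasMultiplicativeReductionAt`, the hypothesis
`End_K(E) = ℤ` being superfluous for such `(E, ℓ)`.
[cite: Faltings1983Endlichkeit, §5 Satz 4 (⊗ ℚ_ℓ form; case of a multiplicative place)] -/
theorem exists_eq_smul_one_of_equivariant_of_not_hasRationalCM_of_hasMultiplicativeReductionAt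
    [NumberField K] {v : HeightOneSpectrum (𝓞 K)} (hℓv : (ℓ : 𝓞 K) ∉ v.asIdeal)
    (hv : W.HasMultiplicativeReductionAt v) :
    exists_eq_smul_one_of_equivariant_of_not_hasRationalCM W ℓ := by
  -- tactic form: a term-mode proof trips the `overlappingInstances` linter on the outer and the
  -- fact's own `[NumberField K]` binder
  intro _ _ _ hnl G hG
  exact exists_eq_smul_one_of_equivariant_of_hasMultiplicativeReductionAt W ℓ hℓv hv hnl G hG

/-- **The core fact of Satz 4 for a curve with `ord_v(j) < 0` at a place `v ∤ 6ℓ`.** For a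
number field `K`, a Weierstrass curve `W` over `K`, a prime `ℓ` and a finite place `v ∤ ℓ` of
residue characteristic `≠ 2, 3` with `ord_v(j(W)) < 0`, the named fact
`exists_eq_smul_one_of_equivariant_of_not_hasRationalCM W ℓ` (`FaltingsECEndCore`) holds — by
`exists_eq_smul_one_of_equivariant_of_one_lt_valuation_j`, the hypothesis `End_K(E) = ℤ` being
superfluous for such `(E, ℓ)`.
[cite: Faltings1983Endlichkeit, §5 Satz 4 (⊗ ℚ_ℓ form; case ord_v(j) < 0, v ∤ 6ℓ)] -/
theorem exists_eq_smul_one_of_equivariant_of_not_hasRationalCM_of_one_lt_valuation_j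
    [NumberField K] [W.IsElliptic] {v : HeightOneSpectrum (𝓞 K)} (hℓv : (ℓ : 𝓞 K) ∉ v.asIdeal)
    (hv2 : v.valuation K (2 : K) = 1) (hv3 : v.valuation K (3 : K) = 1)
    (hj : 1 < v.valuation K W.j) :
    exists_eq_smul_one_of_equivariant_of_not_hasRationalCM W ℓ := by
  intro _ _ _ hnl G hG
  exact exists_eq_smul_one_of_equivariant_of_one_lt_valuation_j W ℓ hℓv hv2 hv3 hj hnl G hG

/-- **Faltings' Satz 4 for an elliptic curve over a number field with a real place**
(unconditional). For a field `K` with a real embedding `φ : K →+* ℝ`, a Weierstrass curve `W`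
over `K` and a prime `ℓ`, the named fact `mem_span_range_tateEndRingHom_iff W ℓ` (`FaltingsEC`;
Faltings 1983, §5 Satz 4 for `A = E`: for `K` a number field and `E` elliptic, a `ℤ_ℓ`-linear
endomorphism of `T_ℓ E` lies in `ℤ_ℓ · End_K(E)` iff it commutes with `Γ_K`, i.e.
`End_K(E) ⊗ ℤ_ℓ ≅ End_{Γ_K}(T_ℓ E)`) holds. Assembly
(`mem_span_range_tateEndRingHom_iff_of_isogenyClass_of_core`, `FaltingsECEndAssemblyProofs`) of
Shafarevich's finiteness of the `K`-isogeny class (*AEC* Cor. IX.6.2, the tree's theorem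
`WeierstrassCurve.finite_isogenyClass_holds`, from
`WeierstrassCurve.shafarevich_finite_goodReductionOutside_holds`, Thm. IX.6.1) and the core fact
for such `K` (`exists_eq_smul_one_of_equivariant_of_not_hasRationalCM_of_realEmbedding`).
[cite: Faltings1983Endlichkeit, §5 Satz 4 (case of a number field with a real place)] -/
theorem mem_span_range_tateEndRingHom_iff_of_realEmbedding (φ : K →+* ℝ) :
    mem_span_range_tateEndRingHom_iff W ℓ :=
  mem_span_range_tateEndRingHom_iff_of_isogenyClass_of_core W ℓ
    (finite_isogenyClass_holds W)
    (exists_eq_smul_one_of_equivariant_of_not_hasRationalCM_of_realEmbedding W ℓ φ)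

/-- **Faltings' Satz 4 for an elliptic curve with a multiplicative place `v ∤ ℓ`**
(unconditional). For a number field `K`, a Weierstrass curve `W` over `K` with multiplicative
reduction at the finite place `v` and a prime `ℓ` with `v ∤ ℓ`, the named fact
`mem_span_range_tateEndRingHom_iff W ℓ` (Faltings 1983, §5 Satz 4 for `A = E`:
`End_K(E) ⊗ ℤ_ℓ ≅ End_{Γ_K}(T_ℓ E)`) holds: assembly of Cor. IX.6.2
(`WeierstrassCurve.finite_isogenyClass_holds`) and the core fact for such `(E, ℓ)`.
[cite: Faltings1983Endlichkeit, §5 Satz 4 (case of a multiplicative place prime to ℓ)] -/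
theorem mem_span_range_tateEndRingHom_iff_of_hasMultiplicativeReductionAt [NumberField K]
    {v : HeightOneSpectrum (𝓞 K)} (hℓv : (ℓ : 𝓞 K) ∉ v.asIdeal)
    (hv : W.HasMultiplicativeReductionAt v) : mem_span_range_tateEndRingHom_iff W ℓ := by
  intro _ _
  exact mem_span_range_tateEndRingHom_iff_of_isogenyClass_of_core W ℓ (finite_isogenyClass_holds W)
    (exists_eq_smul_one_of_equivariant_of_not_hasRationalCM_of_hasMultiplicativeReductionAt W ℓ
      hℓv hv)

/-- **Faltings' Satz 4 for an elliptic curve with `ord_v(j) < 0` at a place `v ∤ 6ℓ`**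
(unconditional): the named fact `mem_span_range_tateEndRingHom_iff W ℓ`
(`End_K(E) ⊗ ℤ_ℓ ≅ End_{Γ_K}(T_ℓ E)`) for `W` over a number field, `ℓ` prime and a finite place
`v ∤ ℓ` of residue characteristic `≠ 2, 3` at which `j(W)` is not integral.
[cite: Faltings1983Endlichkeit, §5 Satz 4 (case ord_v(j) < 0, v ∤ 6ℓ)] -/
theorem mem_span_range_tateEndRingHom_iff_of_one_lt_valuation_j [NumberField K] [W.IsElliptic]
    {v : HeightOneSpectrum (𝓞 K)} (hℓv : (ℓ : 𝓞 K) ∉ v.asIdeal)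
    (hv2 : v.valuation K (2 : K) = 1) (hv3 : v.valuation K (3 : K) = 1)
    (hj : 1 < v.valuation K W.j) : mem_span_range_tateEndRingHom_iff W ℓ := by
  intro _ _
  exact mem_span_range_tateEndRingHom_iff_of_isogenyClass_of_core W ℓ (finite_isogenyClass_holds W)
    (exists_eq_smul_one_of_equivariant_of_not_hasRationalCM_of_one_lt_valuation_j W ℓ hℓv hv2
      hv3 hj)

/-- **Faltings' subspace statement for `E × E` over a number field with a real place**
(unconditional). For a field `K` with a real embedding `φ : K →+* ℝ`, a Weierstrass curve `W`
over `K` and a prime `ℓ`, the named fact `stable_subspace_prod_eq_range W ℓ`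
(`FaltingsECSubspaces`; Faltings 1983, §5, the step "`W` is the image of an idempotent in
`End_K(A) ⊗ ℚ_ℓ`" for `A = E × E`: every `Γ_K`-stable `ℚ_ℓ`-subspace of `V_ℓ E × V_ℓ E` is the
image of some `(a b; c d) ∈ M₂(E_ℓ)`) holds: `stable_subspace_prod_eq_range_of_core`
(`FaltingsECSubspacesProofs`: Shafarevich's Cor. IX.6.2 and the separable quotient isogeny being
theorems of the tree) applied to the core fact for such `K`. [cite: Faltings1983Endlichkeit, §5, Sätze 3–4 (proof, transl. PDF pp. 89–90; case of a real place)] -/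
theorem stable_subspace_prod_eq_range_of_realEmbedding (φ : K →+* ℝ) :
    stable_subspace_prod_eq_range W ℓ :=
  stable_subspace_prod_eq_range_of_core W ℓ
    (exists_eq_smul_one_of_equivariant_of_not_hasRationalCM_of_realEmbedding W ℓ φ)

/-- **Faltings' subspace statement for `E × E` for a curve with a multiplicative place `v ∤ ℓ`**
(unconditional): the named fact `stable_subspace_prod_eq_range W ℓ` (`FaltingsECSubspaces`) for
`W` over a number field with multiplicative reduction at `v` and `v ∤ ℓ`.
[cite: Faltings1983Endlichkeit, §5, Sätze 3–4 (case of a multiplicative place prime to ℓ)] -/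
theorem stable_subspace_prod_eq_range_of_hasMultiplicativeReductionAt [NumberField K]
    {v : HeightOneSpectrum (𝓞 K)} (hℓv : (ℓ : 𝓞 K) ∉ v.asIdeal)
    (hv : W.HasMultiplicativeReductionAt v) : stable_subspace_prod_eq_range W ℓ := by
  intro _ _
  exact stable_subspace_prod_eq_range_of_core W ℓ
    (exists_eq_smul_one_of_equivariant_of_not_hasRationalCM_of_hasMultiplicativeReductionAt W ℓ
      hℓv hv)

/-- **Faltings' subspace statement for `E × E` for a curve with `ord_v(j) < 0` at a place
`v ∤ 6ℓ`** (unconditional): the named fact `stable_subspace_prod_eq_range W ℓ`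
(`FaltingsECSubspaces`). [cite: Faltings1983Endlichkeit, §5, Sätze 3–4 (case ord_v(j) < 0, v ∤ 6ℓ)] -/
theorem stable_subspace_prod_eq_range_of_one_lt_valuation_j [NumberField K] [W.IsElliptic]
    {v : HeightOneSpectrum (𝓞 K)} (hℓv : (ℓ : 𝓞 K) ∉ v.asIdeal)
    (hv2 : v.valuation K (2 : K) = 1) (hv3 : v.valuation K (3 : K) = 1)
    (hj : 1 < v.valuation K W.j) : stable_subspace_prod_eq_range W ℓ := by
  intro _ _
  exact stable_subspace_prod_eq_range_of_core W ℓ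
    (exists_eq_smul_one_of_equivariant_of_not_hasRationalCM_of_one_lt_valuation_j W ℓ hℓv hv2
      hv3 hj)

/-- **Faltings' Korollar 1 for the pair `(E, E)` over a number field with a real place**
(unconditional): the named fact `mem_span_range_tateModule_map_of_equivariant W W ℓ` (every
`Γ_K`-equivariant `ℤ_ℓ`-linear `T_ℓ E → T_ℓ E` is a `ℤ_ℓ`-combination of the `T_ℓ φ`,
`φ : E → E` an isogeny over `K`), from `mem_span_range_tateModule_map_of_equivariant_self_of_isogenyClass_of_core`
with *AEC* Cor. IX.6.2 a theorem and the core fact for such `K`.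
[cite: Faltings1983Endlichkeit, §5 Satz 4, Korollar 1 (case of a real place)] -/
theorem mem_span_range_tateModule_map_of_equivariant_self_of_realEmbedding (φ : K →+* ℝ) :
    mem_span_range_tateModule_map_of_equivariant W W ℓ := by
  intro _ _ _
  exact mem_span_range_tateModule_map_of_equivariant_self_of_isogenyClass_of_core W ℓ
    (finite_isogenyClass_holds W)
    (exists_eq_smul_one_of_equivariant_of_not_hasRationalCM_of_realEmbedding W ℓ φ)

/-- **Faltings' Korollar 1 for `(E, E)` for a curve with a multiplicative place `v ∤ ℓ`**
(unconditional): the named fact `mem_span_range_tateModule_map_of_equivariant W W ℓ`.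
[cite: Faltings1983Endlichkeit, §5 Satz 4, Korollar 1 (case of a multiplicative place prime to ℓ)] -/
theorem mem_span_range_tateModule_map_of_equivariant_self_of_hasMultiplicativeReductionAt
    [NumberField K] {v : HeightOneSpectrum (𝓞 K)} (hℓv : (ℓ : 𝓞 K) ∉ v.asIdeal)
    (hv : W.HasMultiplicativeReductionAt v) :
    mem_span_range_tateModule_map_of_equivariant W W ℓ := by
  intro _ _ _
  exact mem_span_range_tateModule_map_of_equivariant_self_of_isogenyClass_of_core W ℓ
    (finite_isogenyClass_holds W)
    (exists_eq_smul_one_of_equivariant_of_not_hasRationalCM_of_hasMultiplicativeReductionAt W ℓ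
      hℓv hv)

/-- **Faltings' Korollar 1 for `(E, E)` for a curve with `ord_v(j) < 0` at a place `v ∤ 6ℓ`**
(unconditional): the named fact `mem_span_range_tateModule_map_of_equivariant W W ℓ`.
[cite: Faltings1983Endlichkeit, §5 Satz 4, Korollar 1 (case ord_v(j) < 0, v ∤ 6ℓ)] -/
theorem mem_span_range_tateModule_map_of_equivariant_self_of_one_lt_valuation_j
    [NumberField K] [W.IsElliptic] {v : HeightOneSpectrum (𝓞 K)} (hℓv : (ℓ : 𝓞 K) ∉ v.asIdeal)
    (hv2 : v.valuation K (2 : K) = 1) (hv3 : v.valuation K (3 : K) = 1)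
    (hj : 1 < v.valuation K W.j) :
    mem_span_range_tateModule_map_of_equivariant W W ℓ := by
  intro _ _ _
  exact mem_span_range_tateModule_map_of_equivariant_self_of_isogenyClass_of_core W ℓ
    (finite_isogenyClass_holds W)
    (exists_eq_smul_one_of_equivariant_of_not_hasRationalCM_of_one_lt_valuation_j W ℓ hℓv hv2
      hv3 hj)

/-! ## Over `ℚ` -/

/-- The core fact of Satz 4 for an elliptic curve over `ℚ` (real embedding `ℚ ⊆ ℝ`).
[cite: Faltings1983Endlichkeit, §5 Satz 4 (⊗ ℚ_ℓ form; K = ℚ)] -/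
theorem exists_eq_smul_one_of_equivariant_of_not_hasRationalCM_rat (W : WeierstrassCurve ℚ) :
    exists_eq_smul_one_of_equivariant_of_not_hasRationalCM W ℓ :=
  exists_eq_smul_one_of_equivariant_of_not_hasRationalCM_of_realEmbedding W ℓ (Rat.castHom ℝ)

/-- **Faltings' Satz 4 for an elliptic curve over `ℚ`** (unconditional): for `E/ℚ` elliptic and
a prime `ℓ`, a `ℤ_ℓ`-linear endomorphism of `T_ℓ E` lies in `ℤ_ℓ · End_ℚ(E)` iff it commutes
with `Gal(ℚ̄/ℚ)` — the named fact `mem_span_range_tateEndRingHom_iff W ℓ` for `K = ℚ`.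
[cite: Faltings1983Endlichkeit, §5 Satz 4 (K = ℚ)] -/
theorem mem_span_range_tateEndRingHom_iff_rat (W : WeierstrassCurve ℚ) :
    mem_span_range_tateEndRingHom_iff W ℓ :=
  mem_span_range_tateEndRingHom_iff_of_realEmbedding W ℓ (Rat.castHom ℝ)

/-- **Faltings' subspace statement for `E × E` over `ℚ`** (unconditional): the named fact
`stable_subspace_prod_eq_range W ℓ` for `K = ℚ`.
[cite: Faltings1983Endlichkeit, §5, Sätze 3–4 (K = ℚ)] -/
theorem stable_subspace_prod_eq_range_rat (W : WeierstrassCurve ℚ) :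
    stable_subspace_prod_eq_range W ℓ :=
  stable_subspace_prod_eq_range_of_realEmbedding W ℓ (Rat.castHom ℝ)

/-- **Faltings' Korollar 1 for `(E, E)` over `ℚ`** (unconditional): the named fact
`mem_span_range_tateModule_map_of_equivariant W W ℓ` for `K = ℚ`.
[cite: Faltings1983Endlichkeit, §5 Satz 4, Korollar 1 (K = ℚ)] -/
theorem mem_span_range_tateModule_map_of_equivariant_self_rat (W : WeierstrassCurve ℚ) :
    mem_span_range_tateModule_map_of_equivariant W W ℓ := by
  -- tactic form: a term-mode proof trips the `overlappingInstances` linter on the two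
  -- `[W.IsElliptic]` binders of the unfolded fact for the pair `(W, W)`
  intro _ _ _
  exact mem_span_range_tateModule_map_of_equivariant_self_of_realEmbedding W ℓ (Rat.castHom ℝ)

/-! ## `ord_v(j) < 0` at a place `v ∤ ℓ` of any residue characteristic -/

/-- **`End_{Γ_K}(V_ℓ E) = ℚ_ℓ` for irreducible `V_ℓ E` when `ord_v(j(E)) < 0` at some place
`v ∤ ℓ`** (residue characteristics `2, 3` included). Let `K` be a number field, `E/K` an elliptic
curve, `ℓ` a prime and `v ∤ ℓ` a finite place at which `j(E)` is not integral. If `V_ℓ E` has no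
`Γ_K`-stable `ℚ_ℓ`-line, every `Γ_K`-equivariant `ℚ_ℓ`-linear endomorphism of `V_ℓ E` is a
scalar: `exists_codimFixed_eq_one_of_one_lt_valuation_j'` (a quadratic twist is multiplicative at
`v`, by the Tate form of invariant `j(E)`; inertia within `Γ_{K(√d)}` fixes exactly a line) and
`exists_eq_smul_one_of_equivariant_of_codimFixed_eq_one`. This is the full reach of Serre's 1968
argument for curves with non-integral `j` (Ch. IV, §2.2 and A.1) at the places prime to `ℓ`.
[cite: Faltings1983Endlichkeit, §5 Satz 4 (⊗ ℚ_ℓ form; case ord_v(j) < 0, v ∤ ℓ)] -/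
theorem exists_eq_smul_one_of_equivariant_of_one_lt_valuation_j' [NumberField K]
    [W.IsElliptic] {v : HeightOneSpectrum (𝓞 K)} (hℓv : (ℓ : 𝓞 K) ∉ v.asIdeal)
    (hj : 1 < v.valuation K W.j)
    (hnl : ∀ L : Submodule ℚ_[ℓ] (W.rationalTateModule ℓ),
      (∀ σ : Field.absoluteGaloisGroup K, ∀ v ∈ L, rationalGaloisRepTate W ℓ σ v ∈ L) →
        Module.finrank ℚ_[ℓ] L ≠ 1)
    (G : Module.End ℚ_[ℓ] (W.rationalTateModule ℓ))
    (hG : ∀ (σ : Field.absoluteGaloisGroup K) (v : W.rationalTateModule ℓ),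
      G (rationalGaloisRepTate W ℓ σ v) = rationalGaloisRepTate W ℓ σ (G v)) :
    ∃ c : ℚ_[ℓ], G = c • 1 := by
  have hℓK : ((ℓ : ℕ) : K) ≠ 0 := Nat.cast_ne_zero.mpr (Fact.out : ℓ.Prime).ne_zero
  have hcont : Continuous fun x : Field.absoluteGaloisGroup K × RationalTateModule (geomPoints W) ℓ ↦
      rationalTateRepresentation (Field.absoluteGaloisGroup K) (geomPoints W) ℓ x.1 x.2 :=
    continuous_rationalGaloisRepTate_holds W ℓ
  obtain ⟨H, hH⟩ := exists_codimFixed_eq_one_of_one_lt_valuation_j' W ℓ hcont hℓv hj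
  exact exists_eq_smul_one_of_equivariant_of_codimFixed_eq_one W ℓ hℓK hcont H hH hnl G hG

/-- **The core fact of Satz 4 for `(E, ℓ)` with `ord_v(j(E)) < 0` at a place `v ∤ ℓ`** (any
residue characteristic). For a field `K`, a Weierstrass curve `W` over `K` and a prime `ℓ`
with a finite place `v ∤ ℓ` of `K` at which `ord_v(j(W)) < 0`, the named fact
`exists_eq_smul_one_of_equivariant_of_not_hasRationalCM W ℓ` (`FaltingsECEndCore`) holds — by
`exists_eq_smul_one_of_equivariant_of_one_lt_valuation_j'`, the hypothesis `End_K(E) = ℤ` being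
superfluous for such `(E, ℓ)`. After this theorem and `…_of_realEmbedding` the core fact is open
in the tree exactly for `K` totally imaginary and `(E, ℓ)` with `ord_v(j(E)) ≥ 0` at every place
`v ∤ ℓ`. [cite: Faltings1983Endlichkeit, §5 Satz 4 (⊗ ℚ_ℓ form; case ord_v(j) < 0, v ∤ ℓ)] -/
theorem exists_eq_smul_one_of_equivariant_of_not_hasRationalCM_of_one_lt_valuation_j'
    [NumberField K] [W.IsElliptic] {v : HeightOneSpectrum (𝓞 K)} (hℓv : (ℓ : 𝓞 K) ∉ v.asIdeal)
    (hj : 1 < v.valuation K W.j) :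
    exists_eq_smul_one_of_equivariant_of_not_hasRationalCM W ℓ := by
  intro _ _ _ hnl G hG
  exact exists_eq_smul_one_of_equivariant_of_one_lt_valuation_j' W ℓ hℓv hj hnl G hG

/-- **Faltings' Satz 4 for an elliptic curve with `ord_v(j) < 0` at a place `v ∤ ℓ`**
(unconditional; any residue characteristic): the named fact
`mem_span_range_tateEndRingHom_iff W ℓ` (`End_K(E) ⊗ ℤ_ℓ ≅ End_{Γ_K}(T_ℓ E)`), by
`mem_span_range_tateEndRingHom_iff_of_isogenyClass_of_core` with *AEC* Cor. IX.6.2 a theorem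
(`WeierstrassCurve.finite_isogenyClass_holds`) and the core fact for such `(E, ℓ)`.
[cite: Faltings1983Endlichkeit, §5 Satz 4 (case ord_v(j) < 0, v ∤ ℓ)] -/
theorem mem_span_range_tateEndRingHom_iff_of_one_lt_valuation_j' [NumberField K] [W.IsElliptic]
    {v : HeightOneSpectrum (𝓞 K)} (hℓv : (ℓ : 𝓞 K) ∉ v.asIdeal) (hj : 1 < v.valuation K W.j) :
    mem_span_range_tateEndRingHom_iff W ℓ := by
  intro _ _
  exact mem_span_range_tateEndRingHom_iff_of_isogenyClass_of_core W ℓ (finite_isogenyClass_holds W)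
    (exists_eq_smul_one_of_equivariant_of_not_hasRationalCM_of_one_lt_valuation_j' W ℓ hℓv hj)

/-- **Faltings' subspace statement for `E × E` for a curve with `ord_v(j) < 0` at a place
`v ∤ ℓ`** (unconditional; any residue characteristic): the named fact
`stable_subspace_prod_eq_range W ℓ` (`FaltingsECSubspaces`), by `stable_subspace_prod_eq_range_of_core`.
[cite: Faltings1983Endlichkeit, §5, Sätze 3–4 (case ord_v(j) < 0, v ∤ ℓ)] -/
theorem stable_subspace_prod_eq_range_of_one_lt_valuation_j' [NumberField K] [W.IsElliptic]
    {v : HeightOneSpectrum (𝓞 K)} (hℓv : (ℓ : 𝓞 K) ∉ v.asIdeal) (hj : 1 < v.valuation K W.j) :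
    stable_subspace_prod_eq_range W ℓ := by
  intro _ _
  exact stable_subspace_prod_eq_range_of_core W ℓ
    (exists_eq_smul_one_of_equivariant_of_not_hasRationalCM_of_one_lt_valuation_j' W ℓ hℓv hj)

/-- **Faltings' Korollar 1 for `(E, E)` for a curve with `ord_v(j) < 0` at a place `v ∤ ℓ`**
(unconditional; any residue characteristic): the named fact
`mem_span_range_tateModule_map_of_equivariant W W ℓ`.
[cite: Faltings1983Endlichkeit, §5 Satz 4, Korollar 1 (case ord_v(j) < 0, v ∤ ℓ)] -/
theorem mem_span_range_tateModule_map_of_equivariant_self_of_one_lt_valuation_j'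
    [NumberField K] [W.IsElliptic] {v : HeightOneSpectrum (𝓞 K)} (hℓv : (ℓ : 𝓞 K) ∉ v.asIdeal)
    (hj : 1 < v.valuation K W.j) :
    mem_span_range_tateModule_map_of_equivariant W W ℓ := by
  intro _ _ _
  exact mem_span_range_tateModule_map_of_equivariant_self_of_isogenyClass_of_core W ℓ
    (finite_isogenyClass_holds W)
    (exists_eq_smul_one_of_equivariant_of_not_hasRationalCM_of_one_lt_valuation_j' W ℓ hℓv hj)

end Literature.AlgebraicGeometry.Motives

end
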